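import Summits.QuantumFields.YangMills.Theorems.F4SubCurvatureDoorShortRootRigiditySchwarzReflection
import Literature.Algebra.Polynomial.LaplacianOrthogonalInvariance
import Mathlib
import HarnessLib

/-!
# Schwarz reflection for harmonic polynomials across the plane `x₀ − 2x₁ + x₂ = 0`

Companion of `Theorems/F4SubCurvatureDoorShortRootRigiditySchwarzReflection.lean` (plane `x₀+x₁+x₂=0`), needed for stub L2
`stub_sectoralSpan` of the sub-skeleton `Cruxes/ShortRootRigidity/Lines/trigonal_injectivity.lean` (crux ⟨stmt-QuantumFields-23035⟩,
stub `:146`): a harmonic polynomial on `ℝ³` vanishing on the plane `x₀ − 2x₁ + x₂ = 0` is odd under the reflection in that plane.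

Method (rational throughout): in the coordinates `X = (x₀−2x₁+x₂, x₀−x₂, x₀+x₁+x₂)` (mutually orthogonal rows of squared lengths
`6, 2, 3`) the Laplacian becomes `6∂₀² + 2∂₁² + 3∂₂²`; the coefficient recursion in the `X₀`-degree and the vanishing of the slice
`X₀ = 0` kill every coefficient of even `X₀`-degree (the parity lemmas `coeff_bind₁_zero0`, `coeff_bind₁_neg0` of the companion file
are reused).  HONEST LABEL: a lemma; `:146`, ⟨23035⟩, ⟨23125⟩ OPEN; the Yang–Mills mass gap is NOT proved.
-/

noncomputable section

open MvPolynomial Finsupp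
open scoped BigOperators
open Literature.Algebra.Polynomial
open Summit.QuantumFields.YangMills.Theorems.F4SubCurvatureDoorSchwarzReflection

namespace Summit.QuantumFields.YangMills.Theorems.F4SubCurvatureDoorSchwarzReflectionTwo

/-- `M₂ = ∂x/∂X` for `X = (x₀−2x₁+x₂, x₀−x₂, x₀+x₁+x₂)`: columns `(1,−2,1)/6`, `(1,0,−1)/2`, `(1,1,1)/3`. -/
def M₂ : Matrix (Fin 3) (Fin 3) ℝ := !![1 / 6, 1 / 2, 1 / 3; -1 / 3, 0, 1 / 3; 1 / 6, -1 / 2, 1 / 3]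

/-- `x ↦ N₂ x = (x₀−2x₁+x₂, x₀−x₂, x₀+x₁+x₂)` (the inverse of `M₂`). -/
def N₂vec (x : Fin 3 → ℝ) : Fin 3 → ℝ := ![x 0 - 2 * x 1 + x 2, x 0 - x 2, x 0 + x 1 + x 2]

/-- `M₂ (N₂ x) = x`. -/
theorem M₂_mulVec_N₂vec (x : Fin 3 → ℝ) : M₂.mulVec (N₂vec x) = x := by
  funext i
  fin_cases i <;> simp [M₂, N₂vec, Matrix.mulVec, dotProduct, Fin.sum_univ_three] <;> ring

/-- The reflection in `(1,−2,1)^⊥` is `X₀ ↦ −X₀` in the new coordinates. -/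
theorem reflect₂_eq (x : Fin 3 → ℝ) :
    (fun i => x i - (x 0 - 2 * x 1 + x 2) / 3 * (![1, -2, 1] : Fin 3 → ℝ) i) = M₂.mulVec (flip0 (N₂vec x)) := by
  funext i
  fin_cases i <;> simp [M₂, N₂vec, flip0, Matrix.mulVec, dotProduct, Fin.sum_univ_three] <;> ring

/-- The first new coordinate of `M₂ y` is `y₀`. -/
theorem form_M₂_mulVec (y : Fin 3 → ℝ) : M₂.mulVec y 0 - 2 * M₂.mulVec y 1 + M₂.mulVec y 2 = y 0 := by
  simp [M₂, Matrix.mulVec, dotProduct, Fin.sum_univ_three]; ring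

/-- Second-order chain rule for the substitution `x ↦ M₂ X`. -/
theorem pderiv_pderiv_bind₁_M₂ (a a' : Fin 3) (u : MvPolynomial (Fin 3) ℝ) :
    pderiv a (pderiv a' (bind₁ (linSubst M₂) u)) =
      ∑ i : Fin 3, ∑ i' : Fin 3, C (M₂ i a') * (C (M₂ i' a) * bind₁ (linSubst M₂) (pderiv i' (pderiv i u))) := by
  rw [pderiv_bind₁_linSubst, map_sum]
  refine Finset.sum_congr rfl fun i _ => ?_
  rw [pderiv_C_mul, pderiv_bind₁_linSubst, Finset.mul_sum]

/-- The Laplacian in the new coordinates: `L₂ = 6∂₀² + 2∂₁² + 3∂₂²`. -/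
def lap₂ (w : MvPolynomial (Fin 3) ℝ) : MvPolynomial (Fin 3) ℝ :=
  C 6 * pderiv 0 (pderiv 0 w) + C 2 * pderiv 1 (pderiv 1 w) + C 3 * pderiv 2 (pderiv 2 w)

/-- **Transport of the Laplacian**: `L₂ (u∘M₂) = (Δu)∘M₂` (`M₂·diag(6,2,3)·M₂ᵀ = 1`). -/
theorem lap₂_bind₁ (u : MvPolynomial (Fin 3) ℝ) : lap₂ (bind₁ (linSubst M₂) u) = bind₁ (linSubst M₂) (laplacian3 u) := by
  simp only [lap₂, laplacian3, pderiv_pderiv_bind₁_M₂, Fin.sum_univ_three, map_add]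
  simp only [M₂, Matrix.of_apply, Matrix.cons_val', Matrix.cons_val_zero, Matrix.cons_val_one, Matrix.head_cons,
    Matrix.cons_val_two, Matrix.tail_cons, Matrix.empty_val', Matrix.cons_val_fin_one, Matrix.head_fin_const,
    MvPolynomial.C_mul', smul_smul, smul_add]
  norm_num
  module

/-- **Core parity lemma**: `L₂ w = 0` and `w(0,·,·) = 0` force every coefficient with EVEN `X₀`-exponent to vanish. -/
theorem coeff_even_eq_zero₂ (w : MvPolynomial (Fin 3) ℝ) (hL : lap₂ w = 0) (h0 : ∀ y : Fin 3 → ℝ, y 0 = 0 → eval y w = 0)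
    (m b c : ℕ) : coeff (fs (2 * m) b c) w = 0 := by
  have hslice : bind₁ zero0 w = 0 := by
    refine MvPolynomial.funext fun y => ?_
    rw [map_zero, eval_bind₁']
    refine h0 _ ?_
    simp [zero0]
  have hbase : ∀ b c : ℕ, coeff (fs 0 b c) w = 0 := by
    intro b c
    have h := coeff_bind₁_zero0 w (fs 0 b c)
    rw [hslice, coeff_zero] at h
    simpa using h.symm
  have hrec : ∀ a b c : ℕ, (6 * (((a : ℝ) + 2) * (a + 1))) * coeff (fs (a + 2) b c) w =
      -(2 * (((b : ℝ) + 2) * (b + 1)) * coeff (fs a (b + 2) c) w + 3 * (((c : ℝ) + 2) * (c + 1)) * coeff (fs a b (c + 2)) w) := by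
    intro a b c
    have h := congrArg (coeff (fs a b c)) hL
    rw [coeff_zero, lap₂] at h
    simp only [coeff_add, coeff_C_mul, coeff_pderiv_pderiv, fs_add_single] at h
    simp only [Fin.isValue, ↓reduceIte, add_zero, fs_zero, fs_one, fs_two,
      show ((2 : Fin 3) = 0) = False by decide, show ((1 : Fin 3) = 0) = False by decide,
      show ((0 : Fin 3) = 1) = False by decide, show ((2 : Fin 3) = 1) = False by decide,
      show ((0 : Fin 3) = 2) = False by decide, show ((1 : Fin 3) = 2) = False by decide] at h
    push_cast at h
    linear_combination h
  induction m generalizing b c with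
  | zero => simpa using hbase b c
  | succ m ih =>
    have h := hrec (2 * m) b c
    rw [ih (b + 2) c, ih b (c + 2)] at h
    have hne : (6 * ((((2 * m : ℕ) : ℝ) + 2) * (((2 * m : ℕ) : ℝ) + 1))) ≠ 0 := by positivity
    rw [show 2 * (m + 1) = 2 * m + 2 by ring]
    have h' : (6 * ((((2 * m : ℕ) : ℝ) + 2) * (((2 * m : ℕ) : ℝ) + 1))) * coeff (fs (2 * m + 2) b c) w = 0 := by
      linarith
    exact (mul_eq_zero.mp h').resolve_left hne

/-- Hence `w(−X₀, X₁, X₂) = −w` as polynomials. -/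
theorem bind₁_neg0_eq_neg₂ (w : MvPolynomial (Fin 3) ℝ) (hL : lap₂ w = 0) (h0 : ∀ y : Fin 3 → ℝ, y 0 = 0 → eval y w = 0) :
    bind₁ neg0 w = -w := by
  refine MvPolynomial.ext _ _ fun α => ?_
  rw [coeff_bind₁_neg0, coeff_neg]
  rcases Nat.even_or_odd (α 0) with ⟨m, hm⟩ | hodd
  · have hz : coeff α w = 0 := by
      rw [eq_fs α, hm, ← two_mul]
      exact coeff_even_eq_zero₂ w hL h0 m (α 1) (α 2)
    rw [hz, mul_zero, neg_zero]
  · rw [hodd.neg_one_pow]; ring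

/-- … and pointwise. -/
theorem eval_flip0₂ (w : MvPolynomial (Fin 3) ℝ) (hL : lap₂ w = 0) (h0 : ∀ y : Fin 3 → ℝ, y 0 = 0 → eval y w = 0)
    (y : Fin 3 → ℝ) : eval (flip0 y) w = -eval y w := by
  have h1 : eval y (bind₁ neg0 w) = eval (flip0 y) w := by
    have hf : (fun i => eval y (neg0 i)) = flip0 y := by
      funext i
      by_cases hi : i = 0 <;> simp [flip0, neg0, hi]
    rw [eval_bind₁', hf]
  rw [← h1, bind₁_neg0_eq_neg₂ w hL h0, map_neg]

/-- **SCHWARZ REFLECTION across `x₀ − 2x₁ + x₂ = 0` (polynomial form).**  A harmonic polynomial on `ℝ³` vanishing on the plane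
`x₀ − 2x₁ + x₂ = 0` is odd under the reflection `x ↦ x − ((x₀−2x₁+x₂)/3)(1,−2,1)` in that plane. [folklore] -/
theorem eval_reflect₂_eq_neg (u : MvPolynomial (Fin 3) ℝ) (hharm : laplacian3 u = 0)
    (hvan : ∀ x : Fin 3 → ℝ, x 0 - 2 * x 1 + x 2 = 0 → eval x u = 0) (x : Fin 3 → ℝ) :
    eval (fun i => x i - (x 0 - 2 * x 1 + x 2) / 3 * (![1, -2, 1] : Fin 3 → ℝ) i) u = -eval x u := by
  set w := bind₁ (linSubst M₂) u with hw
  have hL : lap₂ w = 0 := by rw [hw, lap₂_bind₁, hharm, map_zero]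
  have h0 : ∀ y : Fin 3 → ℝ, y 0 = 0 → eval y w = 0 := by
    intro y hy
    rw [hw, eval_bind₁_linSubst]
    exact hvan _ (by rw [form_M₂_mulVec, hy])
  rw [reflect₂_eq, ← eval_bind₁_linSubst, ← hw, eval_flip0₂ w hL h0, hw, eval_bind₁_linSubst, M₂_mulVec_N₂vec]

end Summit.QuantumFields.YangMills.Theorems.F4SubCurvatureDoorSchwarzReflectionTwo

end
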